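import Summits.BirchSwinnertonDyer.BirchSwinnertonDyer.Theorems.PrintX11aLowerHalfThreePartner
import Summits.BirchSwinnertonDyer.BirchSwinnertonDyer.Theorems.PrintX11aLowerHalfThreeKodairaMemberByName
import Summits.BirchSwinnertonDyer.BirchSwinnertonDyer.Theorems.PrintX11aLowerHalfBodyOfContraFacts
import HarnessLib

/-!
# Crux `X11aLowerHalf` (item stmt-BirchSwinnertonDyer-19064) at `p = 3` — the partner road and the three-way cut of the deep `p = 3`
# locus RE-KEYED to the line's r6 currency (PRINT-EXACT facts: Kato §17.13 `_contra`, Mazur 4.1 for Cor. 18 ∕ Greenberg 1.5, ODD-keyed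
# Greenberg–Stevens; 19949 retired), with the crux concluded BY NAME — TURNKEY r7 for the lead
# (`--supports stmt-BirchSwinnertonDyer-19064` helper; seat bsd-line-er5-p2 = -w3 width seat of the 19064 line)

HONEST FRAMING. Theorems only; no definition, no named fact, no `sorry`. The two route files are imported (through the lead's
`PrintX11aLowerHalfBodyOfContraFacts.lean`) only so that §3 can conclude the crux decl BY NAME from DISPLAYED hypotheses — a
conditional result, nothing is closed: the hypotheses are 27 named published facts (never proved), the registered `p ≥ 5` certificate
statement, and the two `p = 3` residual statements `hpartner` (per pair a finite certificate; class-wide NOT in the tree) and `htres`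
(the OPEN CORE). BSD is proved for no curve. beyond-print theorem: no.

## What (and why a third file)

The lead's r6 (skeleton 4967d9b672ca, 2026-08-28T11:12Z) retired K2's bundle 19949 from crux L: its composition
`OddChain.x11aLowerHalf_of_printFactsLower_of_muAnFive_of_memberRatEqAtThree` (p626687) reads 22 PRINT-EXACT facts (`stub_printFactsLower`)
and the two `∀`-inputs `stub_muAnSurjDeepFive` (+ 19948) and `stub_memberRatEqAtThree_offKodaira`. This seat's partner road
(`PrintX11aLowerHalfThreePartner.lean`, p627615) and cut (`…ThreePartnerByName.lean`) were keyed to the r4/r5 bundles (γ-keyed Kato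
§17.13 facts, Greenberg 1.5, Cor. 18, all-prime Greenberg–Stevens). Here the SAME theorems are re-keyed to the r6 currency, so that the
lead can cut `stub_memberRatEqAtThree_offKodaira` ↦ `stub_partnerThree` + `stub_lowerTresRamifieThree` WITHOUT re-importing 19949:
* §1 `ClassX11a.missingLowerBoundAt_three_of_partner_of_contraFacts` — the lower half at an X11a pair with `p = 3`, either image, from a
  good-ordinary `3`-congruent partner; the typed divisibility on the non-surjective side by x11a-p2 g3's
  `X11b.multDivisibilityAt_of_katoFacts_of_muAnZeroAt_contra_of_mazur`.
* §2 `lowerThreeDeep_of_kodaira_of_partner_of_tresRamifie_of_contraFacts` — r3's statement `stub_lowerThreeDeep` (the lower half at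
  every deep X11a pair with `p = 3`) from facts + `hpartner` + `htres`; the Kodaira sub-locus through g3's MEMBER
  (`OddChain.memberRatEqAt_three_of_kodaira_of_facts`) and er5 g2's surjective door (the sub-locus has `ρ̄` onto).
* §3 `x11aLowerHalf_body_of_muAnFive_kodaira_partner_tresRamifie_of_contraFacts` (the WHOLE crux body; `p ≥ 5` by Wan's member and
  the lead's contra doors), and the glue `x11aLowerHalf_of_printFactsLower_of_partnerFacts_of_muAnFive_of_partner_of_tresRamifie` :
  (r6's 22-fact bundle VERBATIM) → (the partner road's 5-fact bundle) → `hcert5` → `hpartner` → `htres` →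
  `Theses.ErratumRoadFive.X11aLowerHalf` (and the `PrintX11a` spelling).

References: [EmertonPollackWeston2006] Thm. 1, Thm. 5.1.3, Cor. 5.1.4; [YanZhu2024MainConjNonCM] Thm. 4.9 (v4 Thm. 5.2); [Wan2015] Thm. 4;
[SkinnerUrban2014] Thm. 3.6.4; [Kato2004Asterisque] Thm. 12.4, §17.13; [Mazur1978] Cor. 4.1; [Wuthrich2014] Thm. 3, Lemma 20;
[BalakrishnanEtAl2019] Thm. 1.2; [Miller2011LMS] Def. 1.1; cell files `pub/bsd-stepL/line-er5-p2/g4/` (PARTNER-ROAD.md, turnkey r7).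
-/

set_option autoImplicit false
set_option linter.dupNamespace false -- the directory name repeats the summit name (sibling precedent)

noncomputable section

open scoped Classical MatrixGroups ModularForm

open CongruenceSubgroup UpperHalfPlane WeierstrassCurve IsDedekindDomain Rat.HeightOneSpectrum
  Literature.NumberTheory.EllipticCurves
  Literature.NumberTheory.EllipticCurves.ModularForms
  Literature.NumberTheory.EllipticCurves.Rank1Residual
  Literature.NumberTheory.EllipticCurves.Rank1Residual.Typed
  Literature.NumberTheory.EllipticCurves.Wuthrich2014
  Literature.NumberTheory.EllipticCurves.SteinWuthrich2013
  Literature.NumberTheory.EllipticCurves.Greenberg1999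
  Literature.NumberTheory.EllipticCurves.Kato2004
  Literature.NumberTheory.EllipticCurves.GreenbergVatsal2000
  Literature.NumberTheory.EllipticCurves.EmertonPollackWeston2006
  Literature.NumberTheory.EllipticCurves.SkinnerUrban2014
  Literature.NumberTheory.EllipticCurves.BalakrishnanEtAl2019
  Literature.NumberTheory.GaloisRepresentations
  Literature.NumberTheory.Automorphic
  Summit.BirchSwinnertonDyer.Rank1Residual
  Summit.BirchSwinnertonDyer.Rank1Residual.X11a
  Summit.BirchSwinnertonDyer.BirchSwinnertonDyer.Theorems.OddChain

namespace Summit.BirchSwinnertonDyer.BirchSwinnertonDyer.Theorems.ThreePartner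

/-! ### §1 The partner door at a pair, print-exact currency -/

section Doors

variable {W : WeierstrassCurve ℚ} [W.IsElliptic] [W.IsGloballyMinimal] {p : ℕ} [Fact p.Prime]
  (A : WeierstrassCurve ℚ) [A.IsElliptic] [A.IsGloballyMinimal]

/-- **The lower half at an X11a pair with `p = 3`, ANY image, from a good-ordinary `3`-congruent partner and PRINT-EXACT named facts**
(Yan–Zhu 4.9 [flag @3], period unit at 3, EPW Cor. 5.1.4 ∕ Thm. 1 ×2 at an odd prime [flag EPW06@3-Hida-control], Mazur 4.1,
Kato–Wuthrich A32 + Lemma 20 on the surjective side, Kato 12.4 + §17.13 V′∕VI′∕XI′ `_contra` on the non-surjective side, Stein–Wuthrich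
6.1 ×2, GZK, Greenberg–Stevens at the pair, modularity) — p627615's door with the non-surjective divisibility from x11a-p2 g3's
`X11b.multDivisibilityAt_of_katoFacts_of_muAnZeroAt_contra_of_mazur`. PER PAIR; CONDITIONAL; closes nothing class-wide.
[cite: EmertonPollackWeston2006, Thm. 1, Cor. 5.1.4 (arXiv:math/0404484 pp. 2, 30)] [cite: YanZhu2024MainConjNonCM, Thm. 4.9]
[cite: Kato2004Asterisque, Thm. 12.4 (p. 221), §17.13 (pp. 279–280)] [cite: Wuthrich2014, Thm. 3, Lemma 20 (p. 399)] [cite: Miller2011LMS, Def. 1.1] -/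
theorem _root_.Summit.BirchSwinnertonDyer.Rank1Residual.ClassX11a.missingLowerBoundAt_three_of_partner_of_contraFacts
    (hNf : exists_isNewformOf) (hEPW : cor514_transfer_of_goodOrdinary_odd)
    (hYZ : YanZhu2026.thm49_charIdeal_eq_padicLFunction) (h3 : realPeriodRat_eq_unit_mul_plusPeriod_three)
    (hTa : thm1_muAlg_transfer_goodOrdinary_of_mult_odd) (hTn : thm1_muAn_transfer_goodOrdinary_of_mult_odd)
    (hMz : mazur_not_dvd_maninConstant_of_odd)
    (hKato : kato_charIdeal_dvd_multiplicative_of_surjective) (h20 : lemma20_surjective_threeAdic_of_semistable)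
    (h12 : Kato2004.thm12_4) (hns' : Kato2004.exists_multDivisibilityInputs_nonsplit_contra)
    (hsp' : Kato2004.exists_multDivisibilityInputs_split_contra)
    (hfine' : Kato2004.exists_multDivisibilityInputs_fine_contra)
    (hJs : thm61_splitMultiplicative) (hJn : thm61_nonsplitMultiplicative)
    (hGZK : rank_eq_analyticRank_of_analyticRank_le_one) (hGS : greenberg_stevens (W := W) (p := p))
    (hX : ClassX11a W p) (hp3 : p = 3)
    (hgoodA : A.HasGoodReductionAtPrime p) (hordA : ¬ (p : ℤ) ∣ A.frobeniusTrace p)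
    (hiso : ∃ e : geomTorsion W (p : ℤ) ≃+ geomTorsion A (p : ℤ),
      ∀ (σ : Field.absoluteGaloisGroup ℚ) (P : geomTorsion W (p : ℤ)), e (σ • P) = σ • e P) :
    MissingLowerBoundAt W p := by
  by_cases hsurj : Surj W p
  · exact hX.missingLowerBoundAt_three_of_partner_of_surj A hNf hEPW hYZ h3 hTa hTn hMz hKato h20 hJs hJn hGZK hGS hp3 hsurj
      hgoodA hordA hiso
  · have hμ : X11a.MuAnZeroAt W p := by
      subst hp3
      exact MultThreeMuAn.muAnZeroAt_three_of_mult_of_irr hMz W hX.mult hX.irr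
    exact hX.missingLowerBoundAt_three_of_partner_of_multDivisibilityAt A hNf hEPW hYZ h3 hTa hTn hMz hJs hJn hGZK hGS hp3
      (X11b.multDivisibilityAt_of_katoFacts_of_muAnZeroAt_contra_of_mazur Kato2004.nonempty_iwasawaH1Data_holds h12 hNf hns' hsp'
        hfine' hMz W p hX.ne_two hX.mult hX.irr hsurj hμ)
      hgoodA hordA hiso

end Doors

/-! ### §2 r3's `stub_lowerThreeDeep` from the three-way cut, print-exact currency -/

section ClassLevel

/-- **r3's statement `stub_lowerThreeDeep` (the lower half at every deep X11a pair with `p = 3`, both images) from 26 PRINT-EXACT named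
facts and the two displayed `p = 3` residual statements** `hpartner` (finite-flat off-Kodaira: a good-ordinary `3`-congruent partner per
pair) and `htres` (très-ramifié off-Kodaira: the lower half — the OPEN CORE). The Kodaira sub-locus (`ρ̄` onto ∧ an additive place of
type IV/IV* with `f_v = 2`) through g3's member `OddChain.memberRatEqAt_three_of_kodaira_of_facts` (Ribet's additive drop `hRk`, Skinner–Urban
3.6.4-ram `hSU` [flag @3], Carayol–Livné `hCL`) and er5 g2's surjective door (A32 + Lemma 20; `μ^an(E,3) = 0` by Mazur 4.1).
CONDITIONAL; closes nothing by itself. [cite: SkinnerUrban2014, Thm. 1 (p. 2) = Thm. 3.6.4 (p. 43)] [cite: DarmonDiamondTaylor1995, Thm. 3.15]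
[cite: EmertonPollackWeston2006, Thm. 1, Cor. 5.1.4] [cite: YanZhu2024MainConjNonCM, Thm. 4.9] [cite: Miller2011LMS, Def. 1.1] -/
theorem lowerThreeDeep_of_kodaira_of_partner_of_tresRamifie_of_contraFacts
    (hNf : exists_isNewformOf)
    (h311 : thm311_cotorsion_weightK_member_ofLevel_odd) (hT1a : thm1_muAlg_of_weightK_member_ofLevel_odd)
    (hT1b : thm513_transfer_from_weightK_member_of_bdd_ofLevel_odd)
    (h61 : DeligneSerre1974.thm61_exists_adicGaloisRep) (h326 : Hida2000_thm326_ordinary)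
    (hKato : kato_charIdeal_dvd_multiplicative_of_surjective) (h20 : lemma20_surjective_threeAdic_of_semistable)
    (h12 : Kato2004.thm12_4) (hns' : Kato2004.exists_multDivisibilityInputs_nonsplit_contra)
    (hsp' : Kato2004.exists_multDivisibilityInputs_split_contra)
    (hfine' : Kato2004.exists_multDivisibilityInputs_fine_contra)
    (hMz : mazur_not_dvd_maninConstant_of_odd)
    (hJs : thm61_splitMultiplicative) (hJn : thm61_nonsplitMultiplicative)
    (hGZK : rank_eq_analyticRank_of_analyticRank_le_one)
    (hGS : ∀ (W : WeierstrassCurve ℚ) [W.IsElliptic] [W.IsGloballyMinimal] (p : ℕ) [Fact p.Prime],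
      p ≠ 2 → greenberg_stevens (W := W) (p := p))
    -- the Kodaira sub-locus (g3)
    (hRk : ribet1990_levelLowering_gamma0_newform_at_three_additiveDrop)
    (hSU : thm364_rational_weightK_member_of_bdd_ofLevel_ram)
    (hCL : carayolLivne_additivePrime_dvd_level_of_congruent_newform)
    -- the partner road (g4)
    (hEPW : cor514_transfer_of_goodOrdinary_odd)
    (hYZ : YanZhu2026.thm49_charIdeal_eq_padicLFunction) (h3 : realPeriodRat_eq_unit_mul_plusPeriod_three)
    (hTa : thm1_muAlg_transfer_goodOrdinary_of_mult_odd) (hTn : thm1_muAn_transfer_goodOrdinary_of_mult_odd)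
    -- the two residual statements on the off-Kodaira deep locus at 3
    (hpartner : ∀ (W : WeierstrassCurve ℚ) [W.IsElliptic] [W.IsGloballyMinimal] (p : ℕ) [Fact p.Prime],
      ClassX11a W p → p = 3 → ¬ X11a.ShaAnUnit W p →
      ¬ (Surj W p ∧ ∃ v : HeightOneSpectrum ℤ, W.HasAdditiveReductionAt v ∧
          3 ∣ (W.kodairaSymbolAt v).componentGroupOrder ∧ ¬ natGenerator v ^ 3 ∣ W.conductorNorm ℤ) →
      p ∣ padicValInt p W.minimalDiscriminantInt →
      ∃ (A : WeierstrassCurve ℚ) (_ : A.IsElliptic) (_ : A.IsGloballyMinimal),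
        A.HasGoodReductionAtPrime p ∧ ¬ (p : ℤ) ∣ A.frobeniusTrace p ∧
        ∃ e : geomTorsion W (p : ℤ) ≃+ geomTorsion A (p : ℤ),
          ∀ (σ : Field.absoluteGaloisGroup ℚ) (P : geomTorsion W (p : ℤ)), e (σ • P) = σ • e P)
    (htres : ∀ (W : WeierstrassCurve ℚ) [W.IsElliptic] [W.IsGloballyMinimal] (p : ℕ) [Fact p.Prime],
      ClassX11a W p → p = 3 → ¬ X11a.ShaAnUnit W p →
      ¬ (Surj W p ∧ ∃ v : HeightOneSpectrum ℤ, W.HasAdditiveReductionAt v ∧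
          3 ∣ (W.kodairaSymbolAt v).componentGroupOrder ∧ ¬ natGenerator v ^ 3 ∣ W.conductorNorm ℤ) →
      ¬ p ∣ padicValInt p W.minimalDiscriminantInt → MissingLowerBoundAt W p) :
    ∀ (W : WeierstrassCurve ℚ) [W.IsElliptic] [W.IsGloballyMinimal] (p : ℕ) [Fact p.Prime],
      ClassX11a W p → p = 3 → ¬ X11a.ShaAnUnit W p → MissingLowerBoundAt W p := by
  intro W _ _ p _ hX hp3 hu
  by_cases hK : Surj W p ∧ ∃ v : HeightOneSpectrum ℤ, W.HasAdditiveReductionAt v ∧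
      3 ∣ (W.kodairaSymbolAt v).componentGroupOrder ∧ ¬ natGenerator v ^ 3 ∣ W.conductorNorm ℤ
  · -- the Kodaira sub-locus: g3's member, then the surjective door (`ρ̄` is onto there)
    obtain ⟨hsurj, v, hadd, h3Φ, hf2⟩ := hK
    obtain ⟨M, _, hpM, k, g, ι, hmem, hRat⟩ := memberRatEqAt_three_of_kodaira_of_facts hNf hRk hSU hCL hX hp3 hsurj v hadd h3Φ hf2
    have hμ : X11a.MuAnZeroAt W p := by
      subst hp3
      exact MultThreeMuAn.muAnZeroAt_three_of_mult_of_irr hMz W hX.mult hX.irr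
    have hsurj' : ∀ n : ℕ, W.HasSurjectiveModNGaloisRep (p ^ n : ℕ) := by
      subst hp3
      exact h20 W (Or.inr hX.mult) hsurj
    exact hX.missingLowerBoundAt_of_member_of_ratEq_of_surjective_pow hNf h311 hT1a hT1b h61 h326 hKato hJs hJn hGZK
      (hGS W p hX.ne_two) hsurj' hμ hpM g ι hmem hRat
  · by_cases hff : p ∣ padicValInt p W.minimalDiscriminantInt
    · -- finite flat at 3: the partner road
      obtain ⟨A, hAE, hAM, hgoodA, hordA, hiso⟩ := hpartner W p hX hp3 hu hK hff
      exact hX.missingLowerBoundAt_three_of_partner_of_contraFacts A hNf hEPW hYZ h3 hTa hTn hMz hKato h20 h12 hns' hsp' hfine' hJs hJn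
        hGZK (hGS W p hX.ne_two) hp3 hgoodA hordA hiso
    · -- très ramifié at 3: the open core
      exact htres W p hX hp3 hu hK hff

/-! ### §3 The whole crux body and the crux BY NAME (turnkey r7) -/

/-- **The WHOLE body of crux `X11aLowerHalf` from 27 PRINT-EXACT named facts, the registered `p ≥ 5` certificate statement (`hcert5` =
`stub_muAnDeepFive`'s statement: r6 derives it from 19948 + `stub_muAnSurjDeepFive`) and the two `p = 3` residual statements of §2.**
At `p ≥ 5` exactly as the lead's `OddChain.x11aLowerHalf_body_of_forall_muAn_member_ratEq_of_contraFacts` (Wan's Thm. 4 gives the member,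
`OddChain.memberRatEqAt_of_wan_of_five_le`; Serre for `p`-adic surjectivity; the contra door otherwise); at `p = 3` §2; unit pairs free.
CONDITIONAL; closes nothing by itself. [cite: Wan2015, Thm. 4 (pp. 4–5)] [cite: EmertonPollackWeston2006, Thm. 1, Thm. 5.1.3, Cor. 5.1.4]
[cite: YanZhu2024MainConjNonCM, Thm. 4.9] [cite: Kato2004Asterisque, §17.13 (pp. 279–280)] [cite: GreenbergLNM1716, Conj. 1.11 (shape)]
[cite: Miller2011LMS, Def. 1.1] -/
theorem x11aLowerHalf_body_of_muAnFive_kodaira_partner_tresRamifie_of_contraFacts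
    (hNf : exists_isNewformOf)
    (h311 : thm311_cotorsion_weightK_member_ofLevel_odd) (hT1a : thm1_muAlg_of_weightK_member_ofLevel_odd)
    (hT2 : Wan2015.thm4_rational_weightK_member_of_bdd_ofLevel_irred)
    (hT1b : thm513_transfer_from_weightK_member_of_bdd_ofLevel_odd)
    (h61 : DeligneSerre1974.thm61_exists_adicGaloisRep) (h326 : Hida2000_thm326_ordinary)
    (hKato : kato_charIdeal_dvd_multiplicative_of_surjective) (h20 : lemma20_surjective_threeAdic_of_semistable)
    (h12 : Kato2004.thm12_4) (hns' : Kato2004.exists_multDivisibilityInputs_nonsplit_contra)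
    (hsp' : Kato2004.exists_multDivisibilityInputs_split_contra)
    (hfine' : Kato2004.exists_multDivisibilityInputs_fine_contra)
    (hMz : mazur_not_dvd_maninConstant_of_odd)
    (hJs : thm61_splitMultiplicative) (hJn : thm61_nonsplitMultiplicative)
    (hGZK : rank_eq_analyticRank_of_analyticRank_le_one)
    (hGS : ∀ (W : WeierstrassCurve ℚ) [W.IsElliptic] [W.IsGloballyMinimal] (p : ℕ) [Fact p.Prime],
      p ≠ 2 → greenberg_stevens (W := W) (p := p))
    (hRk : ribet1990_levelLowering_gamma0_newform_at_three_additiveDrop)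
    (hSU : thm364_rational_weightK_member_of_bdd_ofLevel_ram)
    (hCL : carayolLivne_additivePrime_dvd_level_of_congruent_newform)
    (hEPW : cor514_transfer_of_goodOrdinary_odd)
    (hYZ : YanZhu2026.thm49_charIdeal_eq_padicLFunction) (h3 : realPeriodRat_eq_unit_mul_plusPeriod_three)
    (hTa : thm1_muAlg_transfer_goodOrdinary_of_mult_odd) (hTn : thm1_muAn_transfer_goodOrdinary_of_mult_odd)
    (hcert5 : ∀ (W : WeierstrassCurve ℚ) [W.IsElliptic] [W.IsGloballyMinimal] (p : ℕ) [Fact p.Prime],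
      ClassX11a W p → 5 ≤ p → ¬ X11a.ShaAnUnit W p → X11a.MuAnZeroAt W p)
    (hpartner : ∀ (W : WeierstrassCurve ℚ) [W.IsElliptic] [W.IsGloballyMinimal] (p : ℕ) [Fact p.Prime],
      ClassX11a W p → p = 3 → ¬ X11a.ShaAnUnit W p →
      ¬ (Surj W p ∧ ∃ v : HeightOneSpectrum ℤ, W.HasAdditiveReductionAt v ∧
          3 ∣ (W.kodairaSymbolAt v).componentGroupOrder ∧ ¬ natGenerator v ^ 3 ∣ W.conductorNorm ℤ) →
      p ∣ padicValInt p W.minimalDiscriminantInt →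
      ∃ (A : WeierstrassCurve ℚ) (_ : A.IsElliptic) (_ : A.IsGloballyMinimal),
        A.HasGoodReductionAtPrime p ∧ ¬ (p : ℤ) ∣ A.frobeniusTrace p ∧
        ∃ e : geomTorsion W (p : ℤ) ≃+ geomTorsion A (p : ℤ),
          ∀ (σ : Field.absoluteGaloisGroup ℚ) (P : geomTorsion W (p : ℤ)), e (σ • P) = σ • e P)
    (htres : ∀ (W : WeierstrassCurve ℚ) [W.IsElliptic] [W.IsGloballyMinimal] (p : ℕ) [Fact p.Prime],
      ClassX11a W p → p = 3 → ¬ X11a.ShaAnUnit W p →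
      ¬ (Surj W p ∧ ∃ v : HeightOneSpectrum ℤ, W.HasAdditiveReductionAt v ∧
          3 ∣ (W.kodairaSymbolAt v).componentGroupOrder ∧ ¬ natGenerator v ^ 3 ∣ W.conductorNorm ℤ) →
      ¬ p ∣ padicValInt p W.minimalDiscriminantInt → MissingLowerBoundAt W p) :
    ∀ (W : WeierstrassCurve ℚ) [W.IsElliptic] [W.IsGloballyMinimal] (p : ℕ) [Fact p.Prime],
      ClassX11a W p → MissingLowerBoundAt W p := by
  intro W _ _ p hpF hX
  by_cases hu : X11a.ShaAnUnit W p
  · exact x11a_missingLowerBoundAt_of_shaAnUnit hu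
  by_cases hp3 : p = 3
  · exact lowerThreeDeep_of_kodaira_of_partner_of_tresRamifie_of_contraFacts hNf h311 hT1a hT1b h61 h326 hKato h20 h12 hns' hsp'
      hfine' hMz hJs hJn hGZK hGS hRk hSU hCL hEPW hYZ h3 hTa hTn hpartner htres W p hX hp3 hu
  · -- `p ≥ 5`: the certificate + Wan's member + the surjective / contra doors
    have hp5 : 5 ≤ p := (Fact.out : p.Prime).five_le_of_ne_two_of_ne_three hX.ne_two hp3
    have hμ : X11a.MuAnZeroAt W p := hcert5 W p hX hp5 hu
    obtain ⟨M, _, hpM, k, g, ι, hmem, hRat⟩ := memberRatEqAt_of_wan_of_five_le W p hNf hT2 hp5 hX.mult hX.irr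
    by_cases hsurj : Surj W p
    · have hsurj' : ∀ n : ℕ, W.HasSurjectiveModNGaloisRep (p ^ n : ℕ) :=
        kato_charIdeal_dvd_multiplicative_of_surjective.surjective_pow_of_five_le W p hp5 hsurj
      exact hX.missingLowerBoundAt_of_member_of_ratEq_of_surjective_pow hNf h311 hT1a hT1b h61 h326 hKato hJs hJn hGZK
        (hGS W p hX.ne_two) hsurj' hμ hpM g ι hmem hRat
    · exact hX.missingLowerBoundAt_of_member_of_ratEq_of_not_surj_contra hNf h311 hT1a hT1b h61 h326 h12 hns' hsp' hfine' hMz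
        hJs hJn hGZK (hGS W p hX.ne_two) hsurj hμ hpM g ι hmem hRat

/-- **Crux L BY NAME — TURNKEY r7 glue** (CONDITIONAL; the gate records a `conditional-result`; closes nothing): the r6 bundle
`stub_printFactsLower` (22 print-exact facts, VERBATIM its registered statement) `hP`, the partner road's five facts `hQ` (EPW Cor. 5.1.4
good ⟶ mult and Thm. 1 alg ∕ an mult ⟶ good at an odd prime, Yan–Zhu 4.9, period unit at 3), `hcert5` (= r4's `stub_muAnDeepFive`, derived
in r6 from 19948 + `stub_muAnSurjDeepFive`), `hpartner` (proposed `stub_partnerThree`), `htres` (proposed `stub_lowerTresRamifieThree`) ⊢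
`Theses.ErratumRoadFive.X11aLowerHalf`. [cite: GreenbergLNM1716, §1 Conj. 1.11 (p. 61)] [cite: Wan2015, Thm. 4 (pp. 4–5)]
[cite: YanZhu2024MainConjNonCM, Thm. 4.9] [cite: EmertonPollackWeston2006, Cor. 5.1.4] -/
theorem x11aLowerHalf_of_printFactsLower_of_partnerFacts_of_muAnFive_of_partner_of_tresRamifie
    (hP : exists_isNewformOf ∧
      thm311_cotorsion_weightK_member_ofLevel_odd ∧ thm1_muAlg_of_weightK_member_ofLevel_odd ∧
      Wan2015.thm4_rational_weightK_member_of_bdd_ofLevel_irred ∧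
      thm513_transfer_from_weightK_member_of_bdd_ofLevel_odd ∧
      DeligneSerre1974.thm61_exists_adicGaloisRep ∧ Hida2000_thm326_ordinary ∧
      kato_charIdeal_dvd_multiplicative_of_surjective ∧ lemma20_surjective_threeAdic_of_semistable ∧
      Kato2004.thm12_4 ∧
      Kato2004.exists_multDivisibilityInputs_nonsplit_contra ∧
      Kato2004.exists_multDivisibilityInputs_split_contra ∧
      Kato2004.exists_multDivisibilityInputs_fine_contra ∧
      mazur_not_dvd_maninConstant_of_odd ∧
      thm61_splitMultiplicative ∧ thm61_nonsplitMultiplicative ∧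
      rank_eq_analyticRank_of_analyticRank_le_one ∧
      (∀ (W : WeierstrassCurve ℚ) [W.IsElliptic] [W.IsGloballyMinimal] (p : ℕ) [Fact p.Prime],
        p ≠ 2 → greenberg_stevens (W := W) (p := p)) ∧
      thm12_not_le_normalizer_splitCartan ∧
      ribet1990_levelLowering_gamma0_newform_at_three_additiveDrop ∧
      thm364_rational_weightK_member_of_bdd_ofLevel_ram ∧
      carayolLivne_additivePrime_dvd_level_of_congruent_newform)
    (hQ : cor514_transfer_of_goodOrdinary_odd ∧ YanZhu2026.thm49_charIdeal_eq_padicLFunction ∧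
      realPeriodRat_eq_unit_mul_plusPeriod_three ∧ thm1_muAlg_transfer_goodOrdinary_of_mult_odd ∧
      thm1_muAn_transfer_goodOrdinary_of_mult_odd)
    (hcert5 : ∀ (W : WeierstrassCurve ℚ) [W.IsElliptic] [W.IsGloballyMinimal] (p : ℕ) [Fact p.Prime],
      ClassX11a W p → 5 ≤ p → ¬ X11a.ShaAnUnit W p → X11a.MuAnZeroAt W p)
    (hpartner : ∀ (W : WeierstrassCurve ℚ) [W.IsElliptic] [W.IsGloballyMinimal] (p : ℕ) [Fact p.Prime],
      ClassX11a W p → p = 3 → ¬ X11a.ShaAnUnit W p →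
      ¬ (Surj W p ∧ ∃ v : HeightOneSpectrum ℤ, W.HasAdditiveReductionAt v ∧
          3 ∣ (W.kodairaSymbolAt v).componentGroupOrder ∧ ¬ natGenerator v ^ 3 ∣ W.conductorNorm ℤ) →
      p ∣ padicValInt p W.minimalDiscriminantInt →
      ∃ (A : WeierstrassCurve ℚ) (_ : A.IsElliptic) (_ : A.IsGloballyMinimal),
        A.HasGoodReductionAtPrime p ∧ ¬ (p : ℤ) ∣ A.frobeniusTrace p ∧
        ∃ e : geomTorsion W (p : ℤ) ≃+ geomTorsion A (p : ℤ),
          ∀ (σ : Field.absoluteGaloisGroup ℚ) (P : geomTorsion W (p : ℤ)), e (σ • P) = σ • e P)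
    (htres : ∀ (W : WeierstrassCurve ℚ) [W.IsElliptic] [W.IsGloballyMinimal] (p : ℕ) [Fact p.Prime],
      ClassX11a W p → p = 3 → ¬ X11a.ShaAnUnit W p →
      ¬ (Surj W p ∧ ∃ v : HeightOneSpectrum ℤ, W.HasAdditiveReductionAt v ∧
          3 ∣ (W.kodairaSymbolAt v).componentGroupOrder ∧ ¬ natGenerator v ^ 3 ∣ W.conductorNorm ℤ) →
      ¬ p ∣ padicValInt p W.minimalDiscriminantInt → MissingLowerBoundAt W p) :
    Theses.ErratumRoadFive.X11aLowerHalf := by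
  obtain ⟨hNf, h311, hT1a, hT2, hT1b, h61, h326, hKato, h20, h12, hns', hsp', hfine', hMz, hJs, hJn, hGZK, hGS, -, hRk, hSU, hCL⟩ :=
    hP
  obtain ⟨hEPW, hYZ, h3, hTa, hTn⟩ := hQ
  exact x11aLowerHalf_body_of_muAnFive_kodaira_partner_tresRamifie_of_contraFacts hNf h311 hT1a hT2 hT1b h61 h326 hKato h20 h12 hns' hsp'
    hfine' hMz hJs hJn hGZK hGS hRk hSU hCL hEPW hYZ h3 hTa hTn hcert5 hpartner htres

/-- The `PrintX11a` spelling of the same glue (the two route decls are one statement, `Iff.rfl`). [cite: Miller2011LMS, Def. 1.1] -/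
theorem x11aLowerHalf_printX11a_of_printFactsLower_of_partnerFacts_of_muAnFive_of_partner_of_tresRamifie
    (hP : exists_isNewformOf ∧
      thm311_cotorsion_weightK_member_ofLevel_odd ∧ thm1_muAlg_of_weightK_member_ofLevel_odd ∧
      Wan2015.thm4_rational_weightK_member_of_bdd_ofLevel_irred ∧
      thm513_transfer_from_weightK_member_of_bdd_ofLevel_odd ∧
      DeligneSerre1974.thm61_exists_adicGaloisRep ∧ Hida2000_thm326_ordinary ∧
      kato_charIdeal_dvd_multiplicative_of_surjective ∧ lemma20_surjective_threeAdic_of_semistable ∧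
      Kato2004.thm12_4 ∧
      Kato2004.exists_multDivisibilityInputs_nonsplit_contra ∧
      Kato2004.exists_multDivisibilityInputs_split_contra ∧
      Kato2004.exists_multDivisibilityInputs_fine_contra ∧
      mazur_not_dvd_maninConstant_of_odd ∧
      thm61_splitMultiplicative ∧ thm61_nonsplitMultiplicative ∧
      rank_eq_analyticRank_of_analyticRank_le_one ∧
      (∀ (W : WeierstrassCurve ℚ) [W.IsElliptic] [W.IsGloballyMinimal] (p : ℕ) [Fact p.Prime],
        p ≠ 2 → greenberg_stevens (W := W) (p := p)) ∧
      thm12_not_le_normalizer_splitCartan ∧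
      ribet1990_levelLowering_gamma0_newform_at_three_additiveDrop ∧
      thm364_rational_weightK_member_of_bdd_ofLevel_ram ∧
      carayolLivne_additivePrime_dvd_level_of_congruent_newform)
    (hQ : cor514_transfer_of_goodOrdinary_odd ∧ YanZhu2026.thm49_charIdeal_eq_padicLFunction ∧
      realPeriodRat_eq_unit_mul_plusPeriod_three ∧ thm1_muAlg_transfer_goodOrdinary_of_mult_odd ∧
      thm1_muAn_transfer_goodOrdinary_of_mult_odd)
    (hcert5 : ∀ (W : WeierstrassCurve ℚ) [W.IsElliptic] [W.IsGloballyMinimal] (p : ℕ) [Fact p.Prime],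
      ClassX11a W p → 5 ≤ p → ¬ X11a.ShaAnUnit W p → X11a.MuAnZeroAt W p)
    (hpartner : ∀ (W : WeierstrassCurve ℚ) [W.IsElliptic] [W.IsGloballyMinimal] (p : ℕ) [Fact p.Prime],
      ClassX11a W p → p = 3 → ¬ X11a.ShaAnUnit W p →
      ¬ (Surj W p ∧ ∃ v : HeightOneSpectrum ℤ, W.HasAdditiveReductionAt v ∧
          3 ∣ (W.kodairaSymbolAt v).componentGroupOrder ∧ ¬ natGenerator v ^ 3 ∣ W.conductorNorm ℤ) →
      p ∣ padicValInt p W.minimalDiscriminantInt →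
      ∃ (A : WeierstrassCurve ℚ) (_ : A.IsElliptic) (_ : A.IsGloballyMinimal),
        A.HasGoodReductionAtPrime p ∧ ¬ (p : ℤ) ∣ A.frobeniusTrace p ∧
        ∃ e : geomTorsion W (p : ℤ) ≃+ geomTorsion A (p : ℤ),
          ∀ (σ : Field.absoluteGaloisGroup ℚ) (P : geomTorsion W (p : ℤ)), e (σ • P) = σ • e P)
    (htres : ∀ (W : WeierstrassCurve ℚ) [W.IsElliptic] [W.IsGloballyMinimal] (p : ℕ) [Fact p.Prime],
      ClassX11a W p → p = 3 → ¬ X11a.ShaAnUnit W p →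
      ¬ (Surj W p ∧ ∃ v : HeightOneSpectrum ℤ, W.HasAdditiveReductionAt v ∧
          3 ∣ (W.kodairaSymbolAt v).componentGroupOrder ∧ ¬ natGenerator v ^ 3 ∣ W.conductorNorm ℤ) →
      ¬ p ∣ padicValInt p W.minimalDiscriminantInt → MissingLowerBoundAt W p) :
    Theses.PrintX11a.X11aLowerHalf :=
  x11aLowerHalf_of_printFactsLower_of_partnerFacts_of_muAnFive_of_partner_of_tresRamifie hP hQ hcert5 hpartner htres

end ClassLevel

end Summit.BirchSwinnertonDyer.BirchSwinnertonDyer.Theorems.ThreePartner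

end
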